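import Literature.NumberTheory.Automorphic.FuchsianPoincareSeriesBounded
import HarnessLib

/-!
# Selberg–Poincaré series are in `L¹(F) ∩ L²(F) ∩ L^∞` (Motohashi: "Thus `P_m(z, s)` belongs to `L²(F, dμ)`", (2.1.6))
(Motohashi, *Spectral Theory of the Riemann Zeta-Function*, §2.1 (2.1.5)–(2.1.6) and the first line
of the proof of Lemma 2.2, PDF pp. 39, 41)

Corollaries of the boundedness of `P_𝔞m(·, s) = E_𝔞m(· | y^s)` on `ℍ` (`FuchsianPoincareSeriesBounded`) for a
finite volume group with a complete system of inequivalent cusps: for `Re s > 1`, `m ≥ 1`, the series is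
integrable and square integrable on the fundamental domain `F` (`integrableOn_poincare_cpow`,
`memLp_two_poincare_cpow`), and the inner-product integrand of two such series is integrable
(`integrableOn_poincare_cpow_mul_conj`). Everything PROVED (theorems only).

## References
* [Motohashi1997] Y. Motohashi, *Spectral Theory of the Riemann Zeta-Function*, CUP 1997, §2.1 (2.1.6) & proof of Lemma 2.2, PDF pp. 39, 41.

Mathlib: `MeasureTheory.Measure.integrableOn_of_bounded`, `MeasureTheory.memLp_of_bounded`/`MemLp.of_bound`,
`MeasureTheory.MemLp.integrable_mul`. Literature: `exists_bound_norm_poincare_selbergGen`, `continuous_poincare_selbergGen`,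
`translSL_one_mem_cuspPairSet` (`FuchsianPoincareSeriesBounded`); `isAutomorphic_poincare` (`FuchsianPoincareSeries`).
-/

noncomputable section

namespace Literature.NumberTheory.Automorphic

open Matrix UpperHalfPlane
open scoped MatrixGroups

namespace Fuchsian

section PoincareLp

open scoped Pointwise Real ComplexConjugate _root_.ENNReal
open _root_.MeasureTheory Set Filter

variable {Γ : Subgroup (GL (Fin 2) ℝ)} {h : ℕ} {𝔞 : Fin h → OnePoint ℝ} {σ : Fin h → SL(2, ℝ)} {F : Set ℍ}

/-- `|u^s| ≤ 1 · u^{Re s}`. [folklore] -/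
theorem norm_ofReal_cpow_le_one_mul (s : ℂ) : ∀ u : ℝ, 0 < u → ‖((u : ℝ) : ℂ) ^ s‖ ≤ 1 * u ^ s.re := fun u hu => by
  rw [Complex.norm_cpow_eq_rpow_re_of_pos hu, one_mul]

/-- Continuity of `u ↦ u^s` on `(0, ∞)`. [folklore] -/
theorem continuousOn_ofReal_cpow_Ioi (s : ℂ) : ContinuousOn (fun u : ℝ => ((u : ℝ) : ℂ) ^ s) (Ioi 0) := fun u hu =>
  (Complex.continuousAt_ofReal_cpow_const u s (Or.inr (ne_of_gt hu))).continuousWithinAt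

/-- **`P_𝔞ᵢm(·, s)` is bounded, continuous and a.e.-strongly measurable** (packaging). [cite: Motohashi1997, (2.1.6), PDF p. 39] -/
theorem exists_bound_and_continuous_poincare_cpow
    (hΓ : Γ ≤ (Matrix.SpecialLinearGroup.toGL : SL(2, ℝ) →* GL (Fin 2) ℝ).range)
    (hneg : (-1 : GL (Fin 2) ℝ) ∈ Γ) (hd : IsDiscreteSubgroup Γ) (hF : IsHypFundamentalDomain Γ F)
    (hvol : volume F < ⊤)
    (hinfty : ∀ i, (Matrix.SpecialLinearGroup.toGL (σ i) : GL (Fin 2) ℝ) • (OnePoint.infty : OnePoint ℝ) = 𝔞 i)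
    (hper : ∀ i, (ConjAct.toConjAct (Matrix.SpecialLinearGroup.toGL (σ i) : GL (Fin 2) ℝ)⁻¹ • Γ).strictPeriods =
      AddSubgroup.zmultiples 1)
    (hineq : ∀ i j, ∀ γ ∈ Γ, γ • 𝔞 i = 𝔞 j → i = j)
    (hcomplete : ∀ c : OnePoint ℝ, IsCusp c Γ → ∃ i, ∃ γ ∈ Γ, γ • 𝔞 i = c)
    {s : ℂ} (hs : 1 < s.re) {m : ℤ} (hm : 1 ≤ m) (i : Fin h) :
    (∃ B : ℝ, 0 ≤ B ∧ ∀ z : ℍ, ‖poincare Γ (σ i) (selbergGen (fun u : ℝ => ((u : ℝ) : ℂ) ^ s) m) z‖ ≤ B) ∧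
      Continuous (poincare Γ (σ i) (selbergGen (fun u : ℝ => ((u : ℝ) : ℂ) ^ s) m)) := by
  refine ⟨exists_bound_norm_poincare_selbergGen hΓ hneg hd hF hvol hinfty hper hineq hcomplete
    (continuousOn_ofReal_cpow_Ioi s) hs (norm_ofReal_cpow_le_one_mul s) hm i, ?_⟩
  exact continuous_poincare_selbergGen hΓ hd (translSL_one_mem_cuspPairSet (hper i)) (continuousOn_ofReal_cpow_Ioi s) hs
    (norm_ofReal_cpow_le_one_mul s) (by omega)

/-- **`P_𝔞ᵢm(·, s) ∈ L^p(F)` for every `p`** (bounded on a set of finite measure), in particular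
`∈ L²(F)` ("Thus `P_m(z, s)` belongs to `L²(F, dμ)`"). [cite: Motohashi1997, (2.1.6), PDF p. 39] -/
theorem memLp_poincare_cpow
    (hΓ : Γ ≤ (Matrix.SpecialLinearGroup.toGL : SL(2, ℝ) →* GL (Fin 2) ℝ).range)
    (hneg : (-1 : GL (Fin 2) ℝ) ∈ Γ) (hd : IsDiscreteSubgroup Γ) (hF : IsHypFundamentalDomain Γ F)
    (hvol : volume F < ⊤)
    (hinfty : ∀ i, (Matrix.SpecialLinearGroup.toGL (σ i) : GL (Fin 2) ℝ) • (OnePoint.infty : OnePoint ℝ) = 𝔞 i)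
    (hper : ∀ i, (ConjAct.toConjAct (Matrix.SpecialLinearGroup.toGL (σ i) : GL (Fin 2) ℝ)⁻¹ • Γ).strictPeriods =
      AddSubgroup.zmultiples 1)
    (hineq : ∀ i j, ∀ γ ∈ Γ, γ • 𝔞 i = 𝔞 j → i = j)
    (hcomplete : ∀ c : OnePoint ℝ, IsCusp c Γ → ∃ i, ∃ γ ∈ Γ, γ • 𝔞 i = c)
    {s : ℂ} (hs : 1 < s.re) {m : ℤ} (hm : 1 ≤ m) (i : Fin h) (p : ℝ≥0∞) :
    MemLp (poincare Γ (σ i) (selbergGen (fun u : ℝ => ((u : ℝ) : ℂ) ^ s) m)) p (volume.restrict F) := by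
  obtain ⟨⟨B, -, hB⟩, hc⟩ := exists_bound_and_continuous_poincare_cpow hΓ hneg hd hF hvol hinfty hper hineq hcomplete hs hm i
  haveI : IsFiniteMeasure (volume.restrict F) := ⟨by rwa [Measure.restrict_apply_univ]⟩
  exact MemLp.of_bound hc.aestronglyMeasurable.restrict B (Eventually.of_forall hB)

/-- **`P_𝔞ᵢm(·, s) ∈ L¹(F)`.** [cite: Motohashi1997, (2.1.6), PDF p. 39] -/
theorem integrableOn_poincare_cpow
    (hΓ : Γ ≤ (Matrix.SpecialLinearGroup.toGL : SL(2, ℝ) →* GL (Fin 2) ℝ).range)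
    (hneg : (-1 : GL (Fin 2) ℝ) ∈ Γ) (hd : IsDiscreteSubgroup Γ) (hF : IsHypFundamentalDomain Γ F)
    (hvol : volume F < ⊤)
    (hinfty : ∀ i, (Matrix.SpecialLinearGroup.toGL (σ i) : GL (Fin 2) ℝ) • (OnePoint.infty : OnePoint ℝ) = 𝔞 i)
    (hper : ∀ i, (ConjAct.toConjAct (Matrix.SpecialLinearGroup.toGL (σ i) : GL (Fin 2) ℝ)⁻¹ • Γ).strictPeriods =
      AddSubgroup.zmultiples 1)
    (hineq : ∀ i j, ∀ γ ∈ Γ, γ • 𝔞 i = 𝔞 j → i = j)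
    (hcomplete : ∀ c : OnePoint ℝ, IsCusp c Γ → ∃ i, ∃ γ ∈ Γ, γ • 𝔞 i = c)
    {s : ℂ} (hs : 1 < s.re) {m : ℤ} (hm : 1 ≤ m) (i : Fin h) :
    IntegrableOn (poincare Γ (σ i) (selbergGen (fun u : ℝ => ((u : ℝ) : ℂ) ^ s) m)) F :=
  memLp_one_iff_integrable.mp (memLp_poincare_cpow hΓ hneg hd hF hvol hinfty hper hineq hcomplete hs hm i 1)

/-- **The inner-product integrand `P_𝔞ᵢm(z, s₁) conj(P_𝔞ⱼn(z, s̄₂))` is integrable on `F`** (first line of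
the proof of Lemma 2.2: "both … are in `L²(F, dμ)`"). [cite: Motohashi1997, proof of Lemma 2.2, PDF p. 41] -/
theorem integrableOn_poincare_cpow_mul_conj
    (hΓ : Γ ≤ (Matrix.SpecialLinearGroup.toGL : SL(2, ℝ) →* GL (Fin 2) ℝ).range)
    (hneg : (-1 : GL (Fin 2) ℝ) ∈ Γ) (hd : IsDiscreteSubgroup Γ) (hF : IsHypFundamentalDomain Γ F)
    (hvol : volume F < ⊤)
    (hinfty : ∀ i, (Matrix.SpecialLinearGroup.toGL (σ i) : GL (Fin 2) ℝ) • (OnePoint.infty : OnePoint ℝ) = 𝔞 i)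
    (hper : ∀ i, (ConjAct.toConjAct (Matrix.SpecialLinearGroup.toGL (σ i) : GL (Fin 2) ℝ)⁻¹ • Γ).strictPeriods =
      AddSubgroup.zmultiples 1)
    (hineq : ∀ i j, ∀ γ ∈ Γ, γ • 𝔞 i = 𝔞 j → i = j)
    (hcomplete : ∀ c : OnePoint ℝ, IsCusp c Γ → ∃ i, ∃ γ ∈ Γ, γ • 𝔞 i = c)
    {s₁ s₂ : ℂ} (hs₁ : 1 < s₁.re) (hs₂ : 1 < s₂.re) {m n : ℤ} (hm : 1 ≤ m) (hn : 1 ≤ n) (i j : Fin h) :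
    IntegrableOn (fun z : ℍ => poincare Γ (σ i) (selbergGen (fun u : ℝ => ((u : ℝ) : ℂ) ^ s₁) m) z *
        conj (poincare Γ (σ j) (selbergGen (fun u : ℝ => ((u : ℝ) : ℂ) ^ s₂) n) z)) F := by
  have h1 := memLp_poincare_cpow hΓ hneg hd hF hvol hinfty hper hineq hcomplete hs₁ hm i 2
  have h2 := memLp_poincare_cpow hΓ hneg hd hF hvol hinfty hper hineq hcomplete hs₂ hn j 2
  have h2' := Complex.conjCLE.toContinuousLinearMap.comp_memLp' h2
  exact (h1.integrable_mul h2' : _)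

end PoincareLp

end Fuchsian

end Literature.NumberTheory.Automorphic
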